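import Summits.ABC.IUTFork.LDHGenuinePerImagePrintIsm
import Summits.ABC.IUTFork.Thm311RealIsmDHMoverCriterion
import Summits.ABC.IUTFork.Thm311RealInd1StripSignature
import Literature.IUT.LogVolume.TensorPacketFactorwiseOrbitSpan
import HarnessLib

/-!
# The fork at [IUTchIII] Corollary 3.12, L-DH level, READING (P) with the Θ-side computed over PRINT's (Ind1) strip part ⊔ PRINT's (Ind2):
# the print-dominated sub-indeterminacy LIES IN the Dupuy–Hilado container, so its per-image Θ-side is AT MOST the container's
# (abc-iut cell, row «R17 = C:PERIMAGE-PRINT-IND1», the world-B join asked for by abc-iut-c312-d1 2026-08-27; UNCONDITIONAL half)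

Record-only PROOF file (D-0012; no definition, no `Prop` fact) of the abc-iut cell (Cor. 3.12 sub-crew, seat abc-iut-c312-1 =
holder of record of the typed [IUTchIII] Thm. 3.11, gen 14). TAKES NO SIDE on [IUTchIII] Cor. 3.12.

CONTEXT. abc-iut-c312-d1's row «C:PERIMAGE-PRINT-ISM» (`LDHGenuinePrintIsmPacket` / `LDHGenuinePerImagePrintIsm`, p509534 /
p510764) computed the cell's per-image reading (P) of Cor. 3.12 with the Θ-side taken over PRINT's (Ind2) as typed by this lineage
(factorwise `Real.ismIsm (analyticLogv K) v̲_b` = the unit homotheties, abc-iut-w5-d216 p452975): ZERO gain, so that reading FAILS at every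
genuine datum with `l ≥ 5`, `log q^{∤2l}(λ) ≥ 24`; it named as the natural sequel the same join for «the subgroup generated by print's
(Ind1) strip part (`Real.ind1Strip`, c312-1 R-rows) ⊔ print's (Ind2)» — the only print-literal source of hull gain in the cell's typing
(this lineage's movers of record `Thm311RealInd1StripTwist*`, modulo the Jannsen–Wingberg fact). THIS FILE is the UNCONDITIONAL
half of that join — the UPPER bound:

* §1 `trans_mem_ismDH`, **`mem_ismDH_of_mem_closure_ind1Strip_union_ismIsm`** — Dupuy–Hilado's single-place family `Real.ismDH logv (inr v)`
  (bicontinuous `φ` with `φ(I_v) = I_v`, DH §4.9) is closed under composition and inverse and contains print's (Ind1) strip part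
  (`Real.ind1Strip_subset_ismDH`, p450750) and print's (Ind2) (`Real.ismIsm_subset_ismDH`, p442910): the whole subgroup of `Aut_ℚ(K_v)`
  generated by `Real.ind1Strip logv v ∪ Real.ismIsm logv v` lies in `Real.ismDH logv (inr v)`;
* §2 **`mem_indTwo_of_factorwise_ismDH`** — on the tensor packet `X = ⊗_{ℚ_p, i} K_{w_i}` of GENUINE completions (abc-iut-S7's rescaled
  completions), a `ℚ_p`-linear automorphism acting on pure tensors FACTORWISE through elements of `Real.ismDH (analyticLogv K) (inr w_i)`
  LIES IN the Dupuy–Hilado packet container `indTwo = Aut_{ℚ_p}(X : log_p(R_I^×))` (abc-iut-w5-d180's dictionary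
  `exists_mem_latticeAut_of_mem_ismDH`: each factor map is a `ℚ_p`-linear automorphism of `K_{w_i}` mapping `log_p(𝒪^×)` onto itself;
  `TensorPacketFactorwiseOrbitSpan.congr_mem_indTwo`: such a family maps `log_p(R_I^×) = ⊗ log_p(𝒪^×_{w_i})` onto itself); hence
  **`mem_indTwo_of_printInd1Ind2`** for factor maps in the subgroups generated by print's (Ind1) strip part ∪ print's (Ind2)
  ([IUTchIII] Thm. 3.11 (i) p. 154: «Aut_{F⊩×μ}(…)-indeterminacies … acting on … prime-strips» and «independent copies of Ism … on each of the
  direct summands of the j+1 factors» — read factorwise as in c312-d1's `hH`);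
* §3 `localFields_le_indTwo_of_factorwise_ismDH`, **`localFields_lnνLp_hull_ismDH_le_negLogThetaPerImageAt`** — for the genuine real packet
  of a place section (any shell normalisation) and ANY family `H` of subgroups of the packet automorphisms DOMINATED BY `Real.ismDH` factorwise
  (in particular by print's (Ind1) ⊔ (Ind2)): `H ≤ indTwo`, hence `ln ν̄_{𝕃_p}(v⃗ ↦ hull(⋃_{g ∈ H_{v⃗}} g(O_𝕃(−P_Θ)_{v⃗}))) ≤ −|log(Θ)|^{(P)}_p`
  — c312-d1's MONOTONICITY (`realPrimePacketWith_lnνLp_hull_orbitH_le_negLogThetaPerImageAt`, p503117: the Θ-side of reading (P) is monotone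
  in the sub-indeterminacy `H ≤ container`; the free lower bound `…_pilotRegion_le_hull_orbitH` puts the bare value below it) fed with §2;
* §4 input level **`ThetaVolumeInput.sum_lnνLp_hull_printInd1Ind2_le_negLogThetaPerImageNonarch`**, **`…cor312PerImageOf_of_perImage_printInd1Ind2`**
  — the (P)-inequality with the Θ-side computed over ANY print-(Ind1)⊔(Ind2)-dominated `H` IMPLIES the cell's typed `Cor312PerImageOf I`
  (Θ-side over the full container); §5 datum level **`Cor22.ThetaVolumeDatumAt.not_perImage_printInd1Ind2_of_not_cor312PerImageOf`** —
  wherever the typed per-image Corollary is REFUTED at a genuine datum (e.g. this cell's `not_cor312PerImageOf_of_hullEstimatePerImageOf_*`,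
  `exists_not_cor312PerImageOf_deepAtPlace`), the print-(Ind1)⊔(Ind2) reading is refuted there too.

WHAT THIS DOES NOT DO (honest scope). It is an UPPER bound only: it decides NO cell where the container reading holds. Unlike print's (Ind2)
(unit homotheties, zero gain), print's (Ind1) strip part is NOT Θ-region-stabilising in general (modulo the Jannsen–Wingberg structure theorem it
moves ideal-shaped regions at every bad place of a genuine initial Θ-datum: this lineage's p470354 / p482234 / p510525), so c312-d1's zero-gain
identity does NOT extend to it; how much of the container's gain it realises is governed by the additive span of the strip orbit (sequel). Statements about OUR typings (the strip part read through THE equivariant lift and THE logarithm,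
R8/R9; the hull = the `(R_I)^∼`-span, abc-iut-S2); whether print's EFFECTIVE indeterminacies at `v ∈ 𝕍^bad` are these is referee finding
F-B28-1's reading matter; (Ind3), the log-link and Cor. 3.12 itself are untouched; nothing here asserts that abc is proved or refuted;
no side taken. [cite: Mochizuki2012, IUTchIII Thm. 3.11 (i) p. 154; Cor. 3.12 p. 173–174, proof Step (x) p. 181]
[cite: DupuyHilado2025, §4.7, §4.9, §4.12, Thm. 3.10.1] [claim: Mochizuki2012, status: disputed] for every IUT quotation. Axioms: standard three.
-/

noncomputable section

open Set Module NumberField IsDedekindDomain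
open scoped Pointwise TensorProduct

namespace Summit.ABC.IUTFork

open Literature.IUT.LogVolume Literature.NumberTheory.NumberFields Thm311.Real

/-! ## 1. One place: `Real.ismDH` is a group containing print's (Ind1) strip part and print's (Ind2) -/

section OnePlace

variable {K : Type} [Field K] [NumberField K] (logv : PadicLogs K) (v : HeightOneSpectrum (𝓞 K))

/-- `Real.ismDH` at a finite place is closed under composition (`φ.trans ψ = ψ ∘ φ`). [cite: DupuyHilado2025, §4.9] -/
theorem trans_mem_ismDH {φ ψ : Carrier (.inr v : Thm311.Real.Place K) ≃ₗ[ℚ] Carrier (.inr v : Thm311.Real.Place K)}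
    (hφ : φ ∈ ismDH logv (.inr v : Thm311.Real.Place K)) (hψ : ψ ∈ ismDH logv (.inr v : Thm311.Real.Place K)) :
    φ.trans ψ ∈ ismDH logv (.inr v : Thm311.Real.Place K) := by
  obtain ⟨hφc, hφc', hφi⟩ := hφ
  obtain ⟨hψc, hψc', hψi⟩ := hψ
  refine ⟨hψc.comp hφc, hφc'.comp hψc', ?_⟩
  have h : (⇑(φ.trans ψ) : Carrier (.inr v : Thm311.Real.Place K) → Carrier (.inr v : Thm311.Real.Place K)) = ⇑ψ ∘ ⇑φ := rfl
  rw [h, Set.image_comp, hφi, hψi]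

/-- **The subgroup of `Aut_ℚ(K_v)` generated by print's (Ind1) strip part and print's (Ind2) at `v` lies in Dupuy–Hilado's
`Aut_{ℚ_p}(K_v : I_v)`**: `Real.ind1Strip logv v ⊆ Real.ismDH logv (inr v)` (this lineage, p450750), `Real.ismIsm logv v ⊆ Real.ismDH logv (inr v)`
(p442910), and `Real.ismDH logv (inr v)` contains `1` and is closed under composition and inverse (Mathlib's group law on `≃ₗ`:
`φ * ψ = ψ.trans φ`, `φ⁻¹ = φ.symm`). [cite: DupuyHilado2025, §4.9] [cite: Mochizuki2012, IUTchIII Thm. 3.11 (i) p. 154]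
[claim: Mochizuki2012, status: disputed] -/
theorem mem_ismDH_of_mem_closure_ind1Strip_union_ismIsm
    {γ : Carrier (.inr v : Thm311.Real.Place K) ≃ₗ[ℚ] Carrier (.inr v : Thm311.Real.Place K)}
    (hγ : γ ∈ Subgroup.closure (ind1Strip logv v ∪ ismIsm logv v)) : γ ∈ ismDH logv (.inr v : Thm311.Real.Place K) := by
  induction hγ using Subgroup.closure_induction with
  | mem x hx =>
    rcases hx with hx | hx
    · exact ind1Strip_subset_ismDH logv v hx
    · exact ismIsm_subset_ismDH logv v hx
  | one => exact refl_mem_ismDH logv (.inr v)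
  | mul x y _ _ hx hy => exact trans_mem_ismDH logv v hy hx
  | inv x _ hx =>
    obtain ⟨hc, hcs, himg⟩ := hx
    refine ⟨hcs, hc, ?_⟩
    have h := congrArg (fun S => ⇑x.symm '' S) himg
    simp only [Set.image_image, LinearEquiv.symm_apply_apply, Set.image_id'] at h
    exact h.symm

end OnePlace

/-! ## 2. The genuine tensor packet: factorwise `Real.ismDH`-families lie in the container `indTwo` -/

section PrintFactors

variable {K : Type} [Field K] [NumberField K] (p : ℕ) [hp : Fact p.Prime]
variable {I : Type} (w : I → HeightOneSpectrum (𝓞 K)) (hw : ∀ i, ((p : ℕ) : 𝓞 K) ∈ (w i).asIdeal)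

/-- **A FACTORWISE `Real.ismDH`-family lies in the Dupuy–Hilado packet container.** Let `X = ⊗_{ℚ_p, i} K_{w_i}` be the tensor packet of
the GENUINE completions and `g` a `ℚ_p`-linear automorphism of `X` acting on pure tensors factorwise, `g(⊗_i x_i) = ⊗_i ψ_i(x_i)`, through
elements `ψ_i ∈ Real.ismDH (analyticLogv K) (inr w_i)` (bicontinuous, `ψ_i(I_{w_i}) = I_{w_i}`). Each `ψ_i`, read on the rescaled completion,
is a `ℚ_p`-linear automorphism mapping `log_p(𝒪^×_{w_i})` onto itself (abc-iut-w5-d180 `exists_mem_latticeAut_of_mem_ismDH`, analytic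
logarithm), so `g = ⊗_i ψ_i` maps `log_p(R_I^×) = ⊗_i log_p(𝒪^×_{w_i})` onto itself (`congr_mem_indTwo`): `g ∈ indTwo = Aut_{ℚ_p}(X : log_p(R_I^×))`.
[cite: DupuyHilado2025, §4.9] [cite: Mochizuki2012, IUTchIV Prop. 1.2 p. 10] [claim: Mochizuki2012, status: disputed] -/
theorem mem_indTwo_of_factorwise_ismDH
    (ψ : ∀ i, Carrier (.inr (w i) : Thm311.Real.Place K) ≃ₗ[ℚ] Carrier (.inr (w i) : Thm311.Real.Place K))
    (hψ : ∀ i, ψ i ∈ ismDH (analyticLogv K) (.inr (w i) : Thm311.Real.Place K))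
    (g : PacketAlgebra p (fun i => RescaledCompletion K p (w i) (hw i)) ≃ₗ[ℚ_[p]]
      PacketAlgebra p (fun i => RescaledCompletion K p (w i) (hw i)))
    (hg : ∀ x : Π i, RescaledCompletion K p (w i) (hw i),
      g (PiTensorProduct.tprod ℚ_[p] x) =
        PiTensorProduct.tprod ℚ_[p] (fun i =>
          RescaledCompletion.of K p (w i) (hw i) (ψ i ((RescaledCompletion.of K p (w i) (hw i)).symm (x i))))) :
    g ∈ indTwo p (fun i => RescaledCompletion K p (w i) (hw i)) := by
  -- each factor map, read on the rescaled completion, is a lattice automorphism of `log_p(𝒪^×)`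
  have hφ : ∀ i, ∃ φ : RescaledCompletion K p (w i) (hw i) ≃ₗ[ℚ_[p]] RescaledCompletion K p (w i) (hw i),
      φ '' (logUnits (RescaledCompletion K p (w i) (hw i)) : Set (RescaledCompletion K p (w i) (hw i))) =
          logUnits (RescaledCompletion K p (w i) (hw i)) ∧
        ∀ a, φ a = toR p (w i) (hw i) (ψ i (ofR p (w i) (hw i) a)) := by
    intro i
    obtain ⟨n, _, B, hΛ⟩ := exists_basis_coe_logUnits_eq (p := p) (w i) (hw i)
    obtain ⟨φ, hφ, hφa⟩ :=
      exists_mem_latticeAut_of_mem_ismDH (logvAnalyticAt_analyticLogv (F := K) (p := p)) B hΛ (hψ i)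
    refine ⟨φ, ?_, hφa⟩
    rw [hΛ]
    exact latticeAut.image_eq hφ
  choose φ hφimg hφa using hφ
  have hmem := congr_mem_indTwo p (fun i => RescaledCompletion K p (w i) (hw i)) φ hφimg
  -- `g` agrees with `⊗_i φ_i` on pure tensors, hence everywhere
  have heq : (g : PacketAlgebra p (fun i => RescaledCompletion K p (w i) (hw i)) →ₗ[ℚ_[p]]
      PacketAlgebra p (fun i => RescaledCompletion K p (w i) (hw i))) =
      (PiTensorProduct.congr φ : PacketAlgebra p (fun i => RescaledCompletion K p (w i) (hw i)) ≃ₗ[ℚ_[p]]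
        PacketAlgebra p (fun i => RescaledCompletion K p (w i) (hw i))) := by
    refine PiTensorProduct.ext ?_
    ext x
    simp only [LinearMap.compMultilinearMap_apply, LinearEquiv.coe_coe, hg, PiTensorProduct.congr_tprod]
    congr 1
    funext i
    exact (hφa i (x i)).symm
  rw [mem_indTwo_iff]
  intro y
  have hy : g y = PiTensorProduct.congr φ y := LinearMap.congr_fun heq y
  rw [hy]
  exact (mem_indTwo_iff p _ _).1 hmem y

/-- **PRINT's (Ind1) strip part ⊔ PRINT's (Ind2), factorwise, lies in the Dupuy–Hilado packet container.** Same packet; if `g` acts on pure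
tensors factorwise through elements of the subgroups of `Aut_ℚ(K_{w_i})` generated by `Real.ind1Strip (analyticLogv K) w_i ∪ Real.ismIsm
(analyticLogv K) w_i` — [IUTchIII] Thm. 3.11 (i) (Ind1) «Aut_{F⊩×μ}(…)-indeterminacies … prime-strips» (strip part, this lineage's R9) together
with (Ind2) «independent copies of Ism … on each of the direct summands of the j+1 factors» (R8), both as typed by this lineage — then
`g ∈ indTwo`. [cite: Mochizuki2012, IUTchIII Thm. 3.11 (i) p. 154] [cite: DupuyHilado2025, §4.7, §4.9] [claim: Mochizuki2012, status: disputed] -/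
theorem mem_indTwo_of_printInd1Ind2
    (ψ : ∀ i, Carrier (.inr (w i) : Thm311.Real.Place K) ≃ₗ[ℚ] Carrier (.inr (w i) : Thm311.Real.Place K))
    (hψ : ∀ i, ψ i ∈ Subgroup.closure (ind1Strip (analyticLogv K) (w i) ∪ ismIsm (analyticLogv K) (w i)))
    (g : PacketAlgebra p (fun i => RescaledCompletion K p (w i) (hw i)) ≃ₗ[ℚ_[p]]
      PacketAlgebra p (fun i => RescaledCompletion K p (w i) (hw i)))
    (hg : ∀ x : Π i, RescaledCompletion K p (w i) (hw i),
      g (PiTensorProduct.tprod ℚ_[p] x) =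
        PiTensorProduct.tprod ℚ_[p] (fun i =>
          RescaledCompletion.of K p (w i) (hw i) (ψ i ((RescaledCompletion.of K p (w i) (hw i)).symm (x i))))) :
    g ∈ indTwo p (fun i => RescaledCompletion K p (w i) (hw i)) :=
  mem_indTwo_of_factorwise_ismDH p w hw ψ
    (fun i => mem_ismDH_of_mem_closure_ind1Strip_union_ismIsm (analyticLogv K) (w i) (hψ i)) g hg

end PrintFactors

/-! ## 3. The GENUINE real packet of a place section: reading (P) over a print-(Ind1)⊔(Ind2)-dominated `H` is AT MOST the container reading -/

section GenuinePacket

variable {F₀ : Type} [Field F₀] [NumberField F₀] {K : Type} [Field K] [NumberField K] [Algebra F₀ K]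
variable (σ : PlaceSection F₀ K) (p : ℕ) [hp : Fact p.Prime]
variable (c : (j : ℕ) → (Fin (j + 1) → placesOver F₀ p) → ℚ_[p]) (hc0 : ∀ j e, c j e ≠ 0)
  (hcσ : ∀ (j : ℕ) (τ : Equiv.Perm (Fin (j + 1))) (e : Fin (j + 1) → placesOver F₀ p), c j (e ∘ τ) = c j e)

/-- **A family of subgroups dominated by `Real.ismDH` factorwise is a SUB-indeterminacy of the container**: on the genuine packets
`X_{v⃗} = ⊗_b K_{v̲_b}` of a place section, if every `g ∈ H_{v⃗}` acts on pure tensors factorwise through `Real.ismDH (analyticLogv K) (inr v̲_b)`,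
then `H_{v⃗} ≤ indTwo` — the hypothesis `hH` of c312-d1's monotonicity theorems (p503117) HOLDS. [cite: DupuyHilado2025, §4.9]
[claim: Mochizuki2012, status: disputed] -/
theorem localFields_le_indTwo_of_factorwise_ismDH
    (H : (j : ℕ) → (e : Fin (j + 1) → placesOver F₀ p) →
      Subgroup (PacketAlgebra p (fun b => (σ.localFields p).k (e b)) ≃ₗ[ℚ_[p]]
        PacketAlgebra p (fun b => (σ.localFields p).k (e b))))
    (hH : ∀ j e, ∀ g ∈ H j e,
      ∃ ψ : ∀ b : Fin (j + 1), Carrier (.inr (σ.lift (e b).1) : Thm311.Real.Place K) ≃ₗ[ℚ]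
          Carrier (.inr (σ.lift (e b).1) : Thm311.Real.Place K),
        (∀ b, ψ b ∈ ismDH (analyticLogv K) (.inr (σ.lift (e b).1) : Thm311.Real.Place K)) ∧
        ∀ x : ∀ b, (σ.localFields p).k (e b),
          (g : PacketAlgebra p (fun b => (σ.localFields p).k (e b)) ≃ₗ[ℚ_[p]]
              PacketAlgebra p (fun b => (σ.localFields p).k (e b))) (PiTensorProduct.tprod ℚ_[p] x) =
            PiTensorProduct.tprod ℚ_[p] (fun b =>
              RescaledCompletion.of K p (σ.lift (e b).1) (σ.natCast_mem_lift (e b))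
                (ψ b ((RescaledCompletion.of K p (σ.lift (e b).1) (σ.natCast_mem_lift (e b))).symm (x b))))) :
    ∀ j e, H j e ≤ indTwo p (fun b => (σ.localFields p).k (e b)) := by
  intro j e g hg
  obtain ⟨ψ, hψ, hgψ⟩ := hH j e g hg
  exact mem_indTwo_of_factorwise_ismDH p (fun b => σ.lift (e b).1) (fun b => σ.natCast_mem_lift (e b)) ψ hψ g hgψ

/-- **READING (P) OVER A `Real.ismDH`-DOMINATED `H` IS AT MOST THE CONTAINER READING.** For the real packet of the genuine completions of a
place section (any shell normalisation `c`), a `p`-local Θ-idele `t`, and any family `H` of subgroups of the packet automorphisms dominated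
factorwise by Dupuy–Hilado's single-place `Real.ismDH (analyticLogv K)`: `ln ν̄_{𝕃_p}(v⃗ ↦ hull(⋃_{g ∈ H_{v⃗}} g(O_𝕃(−P_Θ)_{v⃗}))) ≤ −|log(Θ)|^{(P)}_p`
— c312-d1's monotonicity `realPrimePacketWith_lnνLp_hull_orbitH_le_negLogThetaPerImageAt` (the Θ-side of reading (P) is MONOTONE in the
sub-indeterminacy; referee finding F-B28-1 «the container is anti-conservative for per-image readings») fed with §2.
[cite: DupuyHilado2025, §4.9, §4.12] [cite: Mochizuki2012, IUTchIII Cor. 3.12 proof Step (x) p. 181] [claim: Mochizuki2012, status: disputed] -/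
theorem localFields_lnνLp_hull_ismDH_le_negLogThetaPerImageAt {lstar : ℕ}
    (t : Fin lstar → (v : placesOver F₀ p) → ((σ.localFields p).k v)ˣ)
    (H : (j : ℕ) → (e : Fin (j + 1) → placesOver F₀ p) →
      Subgroup (PacketAlgebra p (fun b => (σ.localFields p).k (e b)) ≃ₗ[ℚ_[p]]
        PacketAlgebra p (fun b => (σ.localFields p).k (e b))))
    (hH : ∀ j e, ∀ g ∈ H j e,
      ∃ ψ : ∀ b : Fin (j + 1), Carrier (.inr (σ.lift (e b).1) : Thm311.Real.Place K) ≃ₗ[ℚ]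
          Carrier (.inr (σ.lift (e b).1) : Thm311.Real.Place K),
        (∀ b, ψ b ∈ ismDH (analyticLogv K) (.inr (σ.lift (e b).1) : Thm311.Real.Place K)) ∧
        ∀ x : ∀ b, (σ.localFields p).k (e b),
          (g : PacketAlgebra p (fun b => (σ.localFields p).k (e b)) ≃ₗ[ℚ_[p]]
              PacketAlgebra p (fun b => (σ.localFields p).k (e b))) (PiTensorProduct.tprod ℚ_[p] x) =
            PiTensorProduct.tprod ℚ_[p] (fun b =>
              RescaledCompletion.of K p (σ.lift (e b).1) (σ.natCast_mem_lift (e b))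
                (ψ b ((RescaledCompletion.of K p (σ.lift (e b).1) (σ.natCast_mem_lift (e b))).symm (x b))))) :
    (realPrimePacketWith p (σ.localFields p) c hc0 hcσ).lnνLp lstar (fun j e =>
        packetHull p (fun b => (σ.localFields p).k (e b))
          (⋃ g : H j e, (g : PacketAlgebra p (fun b => (σ.localFields p).k (e b)) ≃ₗ[ℚ_[p]]
              PacketAlgebra p (fun b => (σ.localFields p).k (e b))) ''
            (realPrimePacketWith p (σ.localFields p) c hc0 hcσ).pilotRegion t j e)) ≤
      (realPrimePacketWith p (σ.localFields p) c hc0 hcσ).negLogThetaPerImageAt lstar t :=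
  realPrimePacketWith_lnνLp_hull_orbitH_le_negLogThetaPerImageAt p (σ.localFields p) c hc0 hcσ t H
    (localFields_le_indTwo_of_factorwise_ismDH σ p H hH)

end GenuinePacket

end Summit.ABC.IUTFork

/-! ## 4. Input level: the (P)-inequality over print's (Ind1)⊔(Ind2) IMPLIES the typed `Cor312PerImageOf` -/

namespace Literature.IUT.LogVolume

open Summit.ABC.IUTFork Summit.ABC.IUTFork.Thm311.Real Literature.NumberTheory.NumberFields

namespace ThetaVolumeInput

variable {F₀ : Type} [Field F₀] [NumberField F₀] {K : Type} [Field K] [NumberField K] [Algebra F₀ K]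
variable (I : ThetaVolumeInput F₀ K)

/-- **`−|log(Θ)|^{nonarch}` COMPUTED OVER PRINT's (Ind1) STRIP PART ⊔ PRINT's (Ind2) IS AT MOST `−|log(Θ)|^{nonarch}_{(P)}`.** For a genuine
Θ-volume input `I` and ANY family `H = (H_{p,v⃗})` of subgroups of the packet automorphisms of the input's genuine packets dominated
factorwise by the subgroups generated by `Real.ind1Strip (analyticLogv K) v̲_b ∪ Real.ismIsm (analyticLogv K) v̲_b`:
`Σ_{p ∈ T(I)} ln ν̄_{𝕃_p}(v⃗ ↦ hull(⋃_{g ∈ H_{p,v⃗}} g(O_𝕃(−P_Θ)_{v⃗}))) ≤ Σ_{p ∈ T(I)} −|log(Θ)|^{(P)}_p = negLogThetaPerImageNonarch I`.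
[cite: Mochizuki2012, IUTchIII Thm. 3.11 (i) p. 154; Cor. 3.12 proof Step (x) p. 181] [cite: DupuyHilado2025, §4.9, §4.12]
[claim: Mochizuki2012, status: disputed] -/
theorem sum_lnνLp_hull_printInd1Ind2_le_negLogThetaPerImageNonarch
    (H : (p : ℕ) → (hp : p.Prime) → (j : ℕ) → (e : Fin (j + 1) → placesOver F₀ p) →
      haveI : Fact p.Prime := ⟨hp⟩
      Subgroup (PacketAlgebra p (fun b => (I.σ.localFields p).k (e b)) ≃ₗ[ℚ_[p]]
        PacketAlgebra p (fun b => (I.σ.localFields p).k (e b))))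
    (hH : ∀ (p : ℕ) (hp : p.Prime), haveI : Fact p.Prime := ⟨hp⟩
      ∀ j e, ∀ g ∈ H p hp j e,
        ∃ ψ : ∀ b : Fin (j + 1), Carrier (.inr (I.σ.lift (e b).1) : Thm311.Real.Place K) ≃ₗ[ℚ]
            Carrier (.inr (I.σ.lift (e b).1) : Thm311.Real.Place K),
          (∀ b, ψ b ∈ Subgroup.closure
            (ind1Strip (analyticLogv K) (I.σ.lift (e b).1) ∪ ismIsm (analyticLogv K) (I.σ.lift (e b).1))) ∧
          ∀ x : ∀ b, (I.σ.localFields p).k (e b),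
            (g : PacketAlgebra p (fun b => (I.σ.localFields p).k (e b)) ≃ₗ[ℚ_[p]]
                PacketAlgebra p (fun b => (I.σ.localFields p).k (e b))) (PiTensorProduct.tprod ℚ_[p] x) =
              PiTensorProduct.tprod ℚ_[p] (fun b =>
                RescaledCompletion.of K p (I.σ.lift (e b).1) (I.σ.natCast_mem_lift (e b))
                  (ψ b ((RescaledCompletion.of K p (I.σ.lift (e b).1) (I.σ.natCast_mem_lift (e b))).symm (x b))))) :
    (∑ p ∈ I.supportPrimes,
        if hp : p.Prime then
          (haveI : Fact p.Prime := ⟨hp⟩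
           (I.packetAt p hp).lnνLp I.lstar (fun j e =>
             packetHull p (fun b => (I.σ.localFields p).k (e b))
               (⋃ g : H p hp j e, (g : PacketAlgebra p (fun b => (I.σ.localFields p).k (e b)) ≃ₗ[ℚ_[p]]
                   PacketAlgebra p (fun b => (I.σ.localFields p).k (e b))) ''
                 (I.packetAt p hp).pilotRegion (I.tΘ p hp) j e)))
        else 0) ≤
      I.negLogThetaPerImageNonarch := by
  unfold negLogThetaPerImageNonarch
  refine Finset.sum_le_sum fun p hpT => ?_
  have hp : p.Prime := I.prime_of_mem_supportPrimes hpT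
  rw [dif_pos hp, negLogThetaPerImageLoc_of_prime I hp]
  haveI : Fact p.Prime := ⟨hp⟩
  refine localFields_lnνLp_hull_ismDH_le_negLogThetaPerImageAt I.σ p (mScale p (I.σ.localFields p))
    (mScale_ne_zero p (I.σ.localFields p)) (mScale_perm p (I.σ.localFields p)) (I.tΘ p hp) (H p hp) fun j e g hg => ?_
  obtain ⟨ψ, hψ, hgψ⟩ := hH p hp j e g hg
  exact ⟨ψ, fun b => mem_ismDH_of_mem_closure_ind1Strip_union_ismIsm (analyticLogv K) _ (hψ b), hgψ⟩

/-- **The per-image inequality with the Θ-side over PRINT's (Ind1)⊔(Ind2) IMPLIES the cell's typed `Cor312PerImageOf I`** (Θ-side over the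
full Dupuy–Hilado container): IF `−|log(q)| ≤ [−|log(Θ)|^{nonarch} over a print-(Ind1)⊔(Ind2)-dominated H] + ((l+5)/4)·log π` (the (P)-form of
[IUTchIII] Cor. 3.12 with the Θ-side computed over print's single-place indeterminacies as typed by this lineage — HYPOTHESIS, inline), THEN
`Cor312PerImageOf I`. Pure bookkeeping (monotonicity); it discharges nothing and decides no cell on its own; no side taken.
[cite: Mochizuki2012, IUTchIII Cor. 3.12 p. 173–174] [cite: DupuyHilado2025, §4.9, §4.12] [claim: Mochizuki2012, status: disputed] -/
theorem cor312PerImageOf_of_perImage_printInd1Ind2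
    (H : (p : ℕ) → (hp : p.Prime) → (j : ℕ) → (e : Fin (j + 1) → placesOver F₀ p) →
      haveI : Fact p.Prime := ⟨hp⟩
      Subgroup (PacketAlgebra p (fun b => (I.σ.localFields p).k (e b)) ≃ₗ[ℚ_[p]]
        PacketAlgebra p (fun b => (I.σ.localFields p).k (e b))))
    (hH : ∀ (p : ℕ) (hp : p.Prime), haveI : Fact p.Prime := ⟨hp⟩
      ∀ j e, ∀ g ∈ H p hp j e,
        ∃ ψ : ∀ b : Fin (j + 1), Carrier (.inr (I.σ.lift (e b).1) : Thm311.Real.Place K) ≃ₗ[ℚ]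
            Carrier (.inr (I.σ.lift (e b).1) : Thm311.Real.Place K),
          (∀ b, ψ b ∈ Subgroup.closure
            (ind1Strip (analyticLogv K) (I.σ.lift (e b).1) ∪ ismIsm (analyticLogv K) (I.σ.lift (e b).1))) ∧
          ∀ x : ∀ b, (I.σ.localFields p).k (e b),
            (g : PacketAlgebra p (fun b => (I.σ.localFields p).k (e b)) ≃ₗ[ℚ_[p]]
                PacketAlgebra p (fun b => (I.σ.localFields p).k (e b))) (PiTensorProduct.tprod ℚ_[p] x) =
              PiTensorProduct.tprod ℚ_[p] (fun b =>
                RescaledCompletion.of K p (I.σ.lift (e b).1) (I.σ.natCast_mem_lift (e b))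
                  (ψ b ((RescaledCompletion.of K p (I.σ.lift (e b).1) (I.σ.natCast_mem_lift (e b))).symm (x b)))))
    (h : I.negAbsLogQ ≤
      (∑ p ∈ I.supportPrimes,
        if hp : p.Prime then
          (haveI : Fact p.Prime := ⟨hp⟩
           (I.packetAt p hp).lnνLp I.lstar (fun j e =>
             packetHull p (fun b => (I.σ.localFields p).k (e b))
               (⋃ g : H p hp j e, (g : PacketAlgebra p (fun b => (I.σ.localFields p).k (e b)) ≃ₗ[ℚ_[p]]
                   PacketAlgebra p (fun b => (I.σ.localFields p).k (e b))) ''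
                 (I.packetAt p hp).pilotRegion (I.tΘ p hp) j e)))
        else 0) + archLogTheta I.l) :
    I.Cor312PerImageOf := by
  have hle := I.sum_lnνLp_hull_printInd1Ind2_le_negLogThetaPerImageNonarch H hH
  unfold Cor312PerImageOf negLogThetaPerImage
  linarith

end ThetaVolumeInput

/-! ## 5. Datum level: every refuted-as-typed (P) cell is refuted for print's (Ind1)⊔(Ind2) reading too -/

namespace Cor22

namespace ThetaVolumeDatumAt

open Literature.NumberTheory.DiophantineGeometry.GenEll

variable {P : NFPoint} {l : ℕ} (T : ThetaVolumeDatumAt P l)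

/-- **WHERE THE TYPED PER-IMAGE COROLLARY IS REFUTED, THE PRINT-(Ind1)⊔(Ind2) READING IS REFUTED.** At a genuine Θ-volume datum `T` of a
point `(P, l)` with `¬ T.Cor312PerImageOf` (e.g. this cell's `not_cor312PerImageOf_of_hullEstimatePerImageOf_*`, abc-iut-c312-d1 gen 10, or
`exists_not_cor312PerImageOf_deepAtPlace`), for EVERY family `H` of subgroups of the packet automorphisms of `T`'s genuine packets dominated
factorwise by the subgroups generated by print's (Ind1) strip part ∪ print's (Ind2) (this lineage's `Real.ind1Strip`, `Real.ismIsm`):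
`¬ ( −|log(q)| ≤ Σ_p ln ν̄_{𝕃_p}(hull of the H-orbit of O_𝕃(−P_Θ)) + ((l+5)/4)·log π )`. READING (about OUR typings): the container is an UPPER
bound for print's single-place indeterminacies as typed, so every refuted-as-typed (P) cell of record transfers; the converse (whether print's
(Ind1) strip part realises enough of the container's hull gain at the Θ-regions where the container reading HOLDS) is NOT decided here.
[cite: Mochizuki2012, IUTchIII Cor. 3.12 p. 173–174; Thm. 3.11 (i) p. 154] [cite: DupuyHilado2025, §4.9, §4.12] [claim: Mochizuki2012, status: disputed] -/
theorem not_perImage_printInd1Ind2_of_not_cor312PerImageOf (hT : ¬ T.Cor312PerImageOf) :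
    letI := T.instFieldF; letI := T.instNumberFieldF; letI := T.instFieldK; letI := T.instNumberFieldK
    letI := T.instAlgebraK; letI := T.instIsElliptic
    ∀ (H : (p : ℕ) → (hp : p.Prime) → (j : ℕ) →
        (e : Fin (j + 1) → placesOver (Literature.IUT.HodgeTheaters.fieldOfModuli T.E) p) →
        haveI : Fact p.Prime := ⟨hp⟩
        Subgroup (PacketAlgebra p (fun b => (T.I.σ.localFields p).k (e b)) ≃ₗ[ℚ_[p]]
          PacketAlgebra p (fun b => (T.I.σ.localFields p).k (e b)))),
      (∀ (p : ℕ) (hp : p.Prime), haveI : Fact p.Prime := ⟨hp⟩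
        ∀ j e, ∀ g ∈ H p hp j e,
          ∃ ψ : ∀ b : Fin (j + 1), Carrier (.inr (T.I.σ.lift (e b).1) : Thm311.Real.Place T.K) ≃ₗ[ℚ]
              Carrier (.inr (T.I.σ.lift (e b).1) : Thm311.Real.Place T.K),
            (∀ b, ψ b ∈ Subgroup.closure
              (ind1Strip (analyticLogv T.K) (T.I.σ.lift (e b).1) ∪ ismIsm (analyticLogv T.K) (T.I.σ.lift (e b).1))) ∧
            ∀ x : ∀ b, (T.I.σ.localFields p).k (e b),
              (g : PacketAlgebra p (fun b => (T.I.σ.localFields p).k (e b)) ≃ₗ[ℚ_[p]]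
                  PacketAlgebra p (fun b => (T.I.σ.localFields p).k (e b))) (PiTensorProduct.tprod ℚ_[p] x) =
                PiTensorProduct.tprod ℚ_[p] (fun b =>
                  RescaledCompletion.of T.K p (T.I.σ.lift (e b).1) (T.I.σ.natCast_mem_lift (e b))
                    (ψ b ((RescaledCompletion.of T.K p (T.I.σ.lift (e b).1) (T.I.σ.natCast_mem_lift (e b))).symm (x b))))) →
      ¬ (T.negAbsLogQ ≤
          (∑ p ∈ T.I.supportPrimes,
            if hp : p.Prime then
              (haveI : Fact p.Prime := ⟨hp⟩
               (T.I.packetAt p hp).lnνLp T.I.lstar (fun j e =>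
                 packetHull p (fun b => (T.I.σ.localFields p).k (e b))
                   (⋃ g : H p hp j e, (g : PacketAlgebra p (fun b => (T.I.σ.localFields p).k (e b)) ≃ₗ[ℚ_[p]]
                       PacketAlgebra p (fun b => (T.I.σ.localFields p).k (e b))) ''
                     (T.I.packetAt p hp).pilotRegion (T.I.tΘ p hp) j e)))
            else 0) + ThetaVolumeInput.archLogTheta l) := by
  letI := T.instFieldF; letI := T.instNumberFieldF; letI := T.instFieldK; letI := T.instNumberFieldK
  letI := T.instAlgebraK; letI := T.instIsElliptic
  intro H hH h
  have hl' : ThetaVolumeInput.archLogTheta T.I.l = ThetaVolumeInput.archLogTheta l := by rw [T.l_eq]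
  rw [← hl'] at h
  exact hT (T.I.cor312PerImageOf_of_perImage_printInd1Ind2 H hH h)

end ThetaVolumeDatumAt

end Cor22

end Literature.IUT.LogVolume

end
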